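import Mathlib

/-!
# Hodge-locus census, V3-XT `N = 1`: the exact 2-adic valuation law for `j(O_D) − 1728` — combinatorial core

HONEST FRAMING: certified instances and evidence bearing on the general Hodge conjecture; no claim.

Setting (publication cell `pub-hlocus`, engines A/B, theorem R2′ of
`HodgeLocusCensusLemmaR2prime.lean` / `HodgeLocusCensusLemmaR2primeA.lean`): `D = D₀ f²` with `2 ∣ D₀`,
`f` odd, `D ≠ -4`, `N := |D| / 4`, `θ = j(E)` for `E` with CM by `O_D`, `𝔓` a prime above `2` of
`L = K(θ)`, `v_𝔓` normalised by `v_𝔓(2) = 2`.  R2′ says `v_𝔓(θ - 1728) = 14` if `D₀ ≡ 0 (mod 8)`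
(case A) and `≥ 16`, even, if `D₀ ≡ 4 (mod 8)` (case B).

The exact law (engine A, abs-1 gen 23; derivation = Serre–Tate/Deuring reduction to the Hurwitz order
`𝓗 = End(E mod 𝔓)`, Gross–Zagier's deformation count of `div(j - 1728)` on the Lubin–Tate disc
[cite: GrossZagier1985SingularModuli, §2–3], canonical lifts [cite: Gross1986CanonicalLiftings], and the
Gross–Keating length formula at `p = 2` as stated and proved in
[cite: KudlaRapoportYang2006, Thm 3.6.3 and §3.6 pp. 59–66]; the prime `2`, ramified in both `ℚ(i)` and
`ℚ(√D)`, is the case excluded in [cite: LauterViray2015SingularModuli, Thm 1.5]): if `y = bI + cJ + dK ∈ 𝓗`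
(`y² = -N`, `gcd(b,c,d) = 1`) is the reduction of the CM generator, then
`v_𝔓(θ - 1728) = 2 Σ_{U ∈ {I,J,K}} ν₂(T_U)` with `T_U = [[1, b_U],[b_U, N]]`, whose Gross–Keating
invariants are `(0, 1, 1 + v₂(N - b_U²))`, so `ν₂(T_U) = 2 + v₂(N - b_U²)` and
`v_𝔓(θ - 1728) = vLaw b c d := 12 + 2 (v₂(c²+d²) + v₂(b²+d²) + v₂(b²+c²))`
(`c² + d² = Nrd([y, I]) / 4`, etc.).  As `𝔓` varies, `y` runs over the `h(D)` conjugation orbits of such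
elements (`12 h(D)` primitive representations of `N` as a sum of three squares — Gauss).

What THIS FILE proves (kernel-checked, sorry-free; the geometric inputs above are NOT formalised here):
* `gkLength` = the Gross–Keating length of [KRY, Thm 3.6.3] as a function of the GK invariants, and
  `gkLength p 1 (k+1) = k + 2`; the dictionary `vLaw = 2 Σ_U gkLength 2 1 (1 + v₂ M_U)`;
* the evaluation of the law in the residue cases: case A (`b, c` odd, `d` even) gives `14` (= R2′, third
  route); case B (`b` odd, `c = 2c″`, `d = 2d″`) gives `16 + 2 v₂(c″² + d″²)`, hence `16` iff
  `c″² + d″²` odd, `18` iff `c″ d″` odd, `≥ 20` otherwise; the `mod 4` / `mod 8` parity lemmas that sort a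
  primitive representation into these cases (`N ≡ 2 (4)`: two odd coordinates; `N ≡ 1 (4)`: one;
  `N ≡ 5 (8)` ⇒ value `16` at every prime; `N ≡ 1 (8)` ⇒ `≥ 18`);
* census anchors: for `D = -20, -36, -52, -68, -100, -132` the law on orbit representatives reproduces the
  certified valuations (engine A j113205 / engine B R2P, two implementations each).
Instance checks of the full law: all `1249` admissible `D` with `|D| ≤ 10⁴` (per-`D` multisets over the
primes of `L`, and the global corollary `v₂(H_D(1728)) = 6 h(D) + ¼ Σ_{(b,c,d)} v₂(N - b²)`), two
independent implementations, `0` disagreements — see the bundle's `data/abs/xt/n1caseB/`.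
-/

namespace Summit.HodgeConjecture.HodgeConjecture.HodgeLocus.Census.ValJ1728At2

open Finset

/-- The valuation law attached to a representation `N = b² + c² + d²` (coordinates of the pure
quaternion `y = bI + cJ + dK`): `12 + 2 (v₂(c²+d²) + v₂(b²+d²) + v₂(b²+c²))`. -/
def vLaw (b c d : ℕ) : ℕ :=
  12 + 2 * (padicValNat 2 (c ^ 2 + d ^ 2) + padicValNat 2 (b ^ 2 + d ^ 2) + padicValNat 2 (b ^ 2 + c ^ 2))

/-- The Gross–Keating length `ν_p` of [cite: KudlaRapoportYang2006, Thm 3.6.3] as a function of the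
Gross–Keating invariants `(0, a₂, a₃)` of `diag(1, T)`:
`Σ_{j < (a₂+1)/2} (a₂ + a₃ - 4j) p^j` if `a₂` is odd, and
`Σ_{j < a₂/2} (a₂ + a₃ - 4j) p^j + ½ (a₃ - a₂ + 1) p^{a₂/2}` if `a₂` is even. -/
def gkLength (p a₂ a₃ : ℕ) : ℤ :=
  if a₂ % 2 = 1 then ∑ j ∈ range ((a₂ + 1) / 2), ((a₂ : ℤ) + a₃ - 4 * j) * (p : ℤ) ^ j
  else ∑ j ∈ range (a₂ / 2), ((a₂ : ℤ) + a₃ - 4 * j) * (p : ℤ) ^ j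
        + ((a₃ : ℤ) - a₂ + 1) * (p : ℤ) ^ (a₂ / 2) / 2

/-- For Gross–Keating invariants `(0, 1, k + 1)` the length is `k + 2` (any `p`). [cite: KudlaRapoportYang2006, Thm 3.6.3] -/
theorem gkLength_one (p k : ℕ) : gkLength p 1 (k + 1) = k + 2 := by
  have h : gkLength p 1 (k + 1) = ((1 : ℤ) + ((k + 1 : ℕ) : ℤ) - 4 * ((0 : ℕ) : ℤ)) * (p : ℤ) ^ 0 := by
    simp [gkLength]
  rw [h]; push_cast; ring

/-- Dictionary: the law is twice the sum of the three Gross–Keating lengths for the invariants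
`(0, 1, 1 + v₂(M_U))`, `M_I = c² + d²`, `M_J = b² + d²`, `M_K = b² + c²`. -/
theorem vLaw_eq_two_mul_sum_gkLength (b c d : ℕ) :
    (vLaw b c d : ℤ) = 2 * (gkLength 2 1 (padicValNat 2 (c ^ 2 + d ^ 2) + 1)
      + gkLength 2 1 (padicValNat 2 (b ^ 2 + d ^ 2) + 1) + gkLength 2 1 (padicValNat 2 (b ^ 2 + c ^ 2) + 1)) := by
  simp only [gkLength_one, vLaw]; push_cast; ring

/-! ### 2-adic valuation helpers -/

/-- `v₂(n) = 0` for odd `n`. [folklore] -/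
theorem v2_of_odd {n : ℕ} (h : Odd n) : padicValNat 2 n = 0 :=
  padicValNat.eq_zero_of_not_dvd (fun h2 => (Nat.not_even_iff_odd.mpr h) (even_iff_two_dvd.mpr h2))

/-- `v₂(2^k n) = v₂(n) + k` for `n ≠ 0`. [folklore] -/
theorem v2_two_pow_mul (k : ℕ) {n : ℕ} (hn : n ≠ 0) : padicValNat 2 (2 ^ k * n) = padicValNat 2 n + k := by
  rw [padicValNat.mul (pow_ne_zero k two_ne_zero) hn, padicValNat.prime_pow, add_comm]

/-! ### The law in the residue cases -/

/-- Case A (two odd coordinates; `N ≡ 2 (mod 4)`, i.e. `D₀ ≡ 0 (mod 8)`): the value is `14` — the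
statement of theorem R2′ (case A), reached here by the Gross–Zagier / Gross–Keating route. -/
theorem vLaw_caseA {b c d : ℕ} (hb : Odd b) (hc : Odd c) (hd : Even d) : vLaw b c d = 14 := by
  obtain ⟨m, rfl⟩ := hb; obtain ⟨n, rfl⟩ := hc; obtain ⟨l, rfl⟩ := hd
  have h1 : padicValNat 2 ((2 * n + 1) ^ 2 + (l + l) ^ 2) = 0 :=
    v2_of_odd ⟨2 * n ^ 2 + 2 * n + 2 * l ^ 2, by ring⟩
  have h2 : padicValNat 2 ((2 * m + 1) ^ 2 + (l + l) ^ 2) = 0 :=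
    v2_of_odd ⟨2 * m ^ 2 + 2 * m + 2 * l ^ 2, by ring⟩
  have h3 : padicValNat 2 ((2 * m + 1) ^ 2 + (2 * n + 1) ^ 2) = 1 := by
    rw [show (2 * m + 1) ^ 2 + (2 * n + 1) ^ 2 = 2 ^ 1 * (2 * (m ^ 2 + m + n ^ 2 + n) + 1) by ring,
      v2_two_pow_mul 1 (by omega), v2_of_odd ⟨m ^ 2 + m + n ^ 2 + n, rfl⟩]
  simp only [vLaw]; rw [h1, h2, h3]

/-- Case B (`b` odd, `c = 2c″`, `d = 2d″`; `N ≡ 1 (mod 4)`, i.e. `D₀ ≡ 4 (mod 8)`):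
the value is `16 + 2 v₂(c″² + d″²)`. -/
theorem vLaw_caseB {b c d : ℕ} (hb : Odd b) (hcd : c ^ 2 + d ^ 2 ≠ 0) :
    vLaw b (2 * c) (2 * d) = 16 + 2 * padicValNat 2 (c ^ 2 + d ^ 2) := by
  obtain ⟨m, rfl⟩ := hb
  have h1 : padicValNat 2 ((2 * c) ^ 2 + (2 * d) ^ 2) = padicValNat 2 (c ^ 2 + d ^ 2) + 2 := by
    rw [show (2 * c) ^ 2 + (2 * d) ^ 2 = 2 ^ 2 * (c ^ 2 + d ^ 2) by ring, v2_two_pow_mul 2 hcd]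
  have h2 : padicValNat 2 ((2 * m + 1) ^ 2 + (2 * d) ^ 2) = 0 :=
    v2_of_odd ⟨2 * m ^ 2 + 2 * m + 2 * d ^ 2, by ring⟩
  have h3 : padicValNat 2 ((2 * m + 1) ^ 2 + (2 * c) ^ 2) = 0 :=
    v2_of_odd ⟨2 * m ^ 2 + 2 * m + 2 * c ^ 2, by ring⟩
  simp only [vLaw]; rw [h1, h2, h3]; ring

/-- Case B with `c″² + d″²` odd (`N ≡ 5 (mod 8)`): the value is `16` (at every prime). -/
theorem vLaw_caseB_sixteen {b c d : ℕ} (hb : Odd b) (hcd : Odd (c ^ 2 + d ^ 2)) :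
    vLaw b (2 * c) (2 * d) = 16 := by
  rw [vLaw_caseB hb (by rintro h; rw [h] at hcd; exact Nat.not_odd_zero hcd), v2_of_odd hcd]

/-- Case B with `c″, d″` both odd: the value is `18`. -/
theorem vLaw_caseB_eighteen {b c d : ℕ} (hb : Odd b) (hc : Odd c) (hd : Odd d) :
    vLaw b (2 * c) (2 * d) = 18 := by
  obtain ⟨m, rfl⟩ := hc; obtain ⟨n, rfl⟩ := hd
  rw [vLaw_caseB hb (by positivity),
    show (2 * m + 1) ^ 2 + (2 * n + 1) ^ 2 = 2 ^ 1 * (2 * (m ^ 2 + m + n ^ 2 + n) + 1) by ring,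
    v2_two_pow_mul 1 (by omega), v2_of_odd ⟨m ^ 2 + m + n ^ 2 + n, rfl⟩]

/-- Case B with `c″, d″` both even (not both zero): the value is at least `20`. -/
theorem vLaw_caseB_ge_twenty {b c d : ℕ} (hb : Odd b) (hc : Even c) (hd : Even d)
    (hcd : c ^ 2 + d ^ 2 ≠ 0) : 20 ≤ vLaw b (2 * c) (2 * d) := by
  obtain ⟨m, rfl⟩ := hc; obtain ⟨n, rfl⟩ := hd
  have hmn : m ^ 2 + n ^ 2 ≠ 0 := by
    intro h; apply hcd; nlinarith [sq_nonneg m, sq_nonneg n]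
  rw [vLaw_caseB hb hcd,
    show (m + m) ^ 2 + (n + n) ^ 2 = 2 ^ 2 * (m ^ 2 + n ^ 2) by ring, v2_two_pow_mul 2 hmn]
  omega

/-! ### Sorting a primitive representation into the cases (`mod 4` / `mod 8` parity lemmas) -/

/-- `N ≡ 2 (mod 4)` (case A): exactly two of the three coordinates are odd. -/
theorem parity_caseA (b c d : ZMod 4) (h : b ^ 2 + c ^ 2 + d ^ 2 = 2) :
    (b ^ 2 = 1 ∧ c ^ 2 = 1 ∧ d ^ 2 = 0) ∨ (b ^ 2 = 1 ∧ c ^ 2 = 0 ∧ d ^ 2 = 1) ∨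
      (b ^ 2 = 0 ∧ c ^ 2 = 1 ∧ d ^ 2 = 1) := by
  revert h b c d; decide

/-- `N ≡ 1 (mod 4)` (case B): exactly one coordinate is odd. -/
theorem parity_caseB (b c d : ZMod 4) (h : b ^ 2 + c ^ 2 + d ^ 2 = 1) :
    (b ^ 2 = 1 ∧ c ^ 2 = 0 ∧ d ^ 2 = 0) ∨ (b ^ 2 = 0 ∧ c ^ 2 = 1 ∧ d ^ 2 = 0) ∨
      (b ^ 2 = 0 ∧ c ^ 2 = 0 ∧ d ^ 2 = 1) := by
  revert h b c d; decide

/-- `N ≡ 3 (mod 4)` and `N ≡ 0 (mod 4)` do not occur for primitive representations relevant here: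
a sum of three squares is `≡ 3 (mod 4)` only if all are odd, `≡ 0 (mod 4)` only if all are even. -/
theorem parity_other (b c d : ZMod 4) :
    (b ^ 2 + c ^ 2 + d ^ 2 = 3 → b ^ 2 = 1 ∧ c ^ 2 = 1 ∧ d ^ 2 = 1) ∧
      (b ^ 2 + c ^ 2 + d ^ 2 = 0 → b ^ 2 = 0 ∧ c ^ 2 = 0 ∧ d ^ 2 = 0) := by
  revert b c d; decide

/-- Case B split by `N mod 8`: with `b` odd and `N = b² + 4 (c″² + d″²)`,
`N ≡ 5 (mod 8)` iff `c″² + d″²` is odd (value `16`), `N ≡ 1 (mod 8)` iff it is even (value `≥ 18`). -/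
theorem caseB_mod_eight (b c d : ZMod 8) (hb : b ^ 2 = 1) :
    (b ^ 2 + 4 * (c ^ 2 + d ^ 2) = 5 ↔ (c ^ 2 + d ^ 2 = 1 ∨ c ^ 2 + d ^ 2 = 5)) ∧
      (b ^ 2 + 4 * (c ^ 2 + d ^ 2) = 1 ↔ (c ^ 2 + d ^ 2 = 0 ∨ c ^ 2 + d ^ 2 = 2 ∨ c ^ 2 + d ^ 2 = 4)) := by
  revert hb b c d; decide

/-! ### Census anchors (orbit representatives `(b, c, d)`, `N = |D|/4`; certified values engines A/B) -/

/-- `D = -20` (`N = 5`, `h = 2`, reps `(1,0,2)`, `(1,2,0)`): both primes `16`.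
`D = -52` (`N = 13`, reps `(3,2,0)`, `(3,0,2)`): `16, 16`.
`D = -36` (`N = 9`, reps `(1,2,2)` twice; the Lauter–Viray exceptional discriminant `-4·3²`): `18, 18`.
`D = -68` (`N = 17`, `h = 4`, reps `(1,0,4)`, `(1,4,0)`, `(3,2,2)` twice): `20, 20, 18, 18`.
`D = -100` (`N = 25`, reps `(3,4,0)`, `(3,0,4)`): `20, 20`.
`D = -132` (`N = 33`, reps `(5,2,2)` twice, `(1,4,4)` twice): `18, 18, 22, 22`. -/
theorem anchors :
    vLaw 1 (2 * 0) (2 * 1) = 16 ∧ vLaw 3 (2 * 1) (2 * 0) = 16 ∧ vLaw 1 (2 * 1) (2 * 1) = 18 ∧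
    vLaw 1 (2 * 0) (2 * 2) = 20 ∧ vLaw 3 (2 * 1) (2 * 1) = 18 ∧ vLaw 3 (2 * 2) (2 * 0) = 20 ∧
    vLaw 5 (2 * 1) (2 * 1) = 18 ∧ vLaw 1 (2 * 2) (2 * 2) = 22 := by
  have h16a : vLaw 1 (2 * 0) (2 * 1) = 16 := vLaw_caseB_sixteen ⟨0, rfl⟩ ⟨0, rfl⟩
  have h16b : vLaw 3 (2 * 1) (2 * 0) = 16 := vLaw_caseB_sixteen ⟨1, rfl⟩ ⟨0, rfl⟩
  have h18a : vLaw 1 (2 * 1) (2 * 1) = 18 := vLaw_caseB_eighteen ⟨0, rfl⟩ ⟨0, rfl⟩ ⟨0, rfl⟩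
  have h18b : vLaw 3 (2 * 1) (2 * 1) = 18 := vLaw_caseB_eighteen ⟨1, rfl⟩ ⟨0, rfl⟩ ⟨0, rfl⟩
  have h18c : vLaw 5 (2 * 1) (2 * 1) = 18 := vLaw_caseB_eighteen ⟨2, rfl⟩ ⟨0, rfl⟩ ⟨0, rfl⟩
  have h4 : padicValNat 2 4 = 2 := by
    rw [show (4 : ℕ) = 2 ^ 2 * 1 by norm_num, v2_two_pow_mul 2 one_ne_zero]; simp
  have h8 : padicValNat 2 8 = 3 := by
    rw [show (8 : ℕ) = 2 ^ 3 * 1 by norm_num, v2_two_pow_mul 3 one_ne_zero]; simp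
  have h20a : vLaw 1 (2 * 0) (2 * 2) = 20 := by
    rw [vLaw_caseB (b := 1) (c := 0) (d := 2) ⟨0, rfl⟩ (by norm_num)]; norm_num [h4]
  have h20b : vLaw 3 (2 * 2) (2 * 0) = 20 := by
    rw [vLaw_caseB (b := 3) (c := 2) (d := 0) ⟨1, rfl⟩ (by norm_num)]; norm_num [h4]
  have h22 : vLaw 1 (2 * 2) (2 * 2) = 22 := by
    rw [vLaw_caseB (b := 1) (c := 2) (d := 2) ⟨0, rfl⟩ (by norm_num)]; norm_num [h8]
  exact ⟨h16a, h16b, h18a, h20a, h18b, h20b, h18c, h22⟩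

/-- Case A anchors: `D = -8` (`N = 2`, rep `(1,1,0)`), `D = -24` (`N = 6`, rep `(1,1,2)`),
`D = -40` (`N = 10`, rep `(3,1,0)`): value `14` (theorem R2′, case A). -/
theorem anchors_caseA : vLaw 1 1 0 = 14 ∧ vLaw 1 1 2 = 14 ∧ vLaw 3 1 0 = 14 :=
  ⟨vLaw_caseA ⟨0, rfl⟩ ⟨0, rfl⟩ ⟨0, rfl⟩, vLaw_caseA ⟨0, rfl⟩ ⟨0, rfl⟩ ⟨1, rfl⟩,
    vLaw_caseA ⟨1, rfl⟩ ⟨0, rfl⟩ ⟨0, rfl⟩⟩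

/-- Global corollary at the anchors: `v₂(H_D(1728)) = ½ Σ_orbits vLaw`:
`D = -68`: `(20 + 20 + 18 + 18)/2 = 38`; `D = -132`: `(18 + 18 + 22 + 22)/2 = 40`; `D = -20`: `16`
(certified: exact `H_D(1728)`, engine A j113205). -/
theorem anchors_global : (20 + 20 + 18 + 18) / 2 = (38 : ℕ) ∧ (18 + 18 + 22 + 22) / 2 = (40 : ℕ) ∧
    (16 + 16) / 2 = (16 : ℕ) := by decide

end Summit.HodgeConjecture.HodgeConjecture.HodgeLocus.Census.ValJ1728At2
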